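import Summits.ABC.IUTFork.Repair.CandMochizuki41
import Summits.ABC.IUTFork.Cor312UnitCosetCoarse
import Summits.ABC.IUTFork.Repair.ObstructionSS32
import Summits.ABC.IUTFork.Repair.CandJoshi23Price
import HarnessLib

/-!
# IUT REPAIR — cross-checker: row RP-M51 ((C14)/(Lin) «highly non-linear», abc-iut-rp-m4 `Repair.CandMochizuki41`, file k = 41) on the cx columns K, SCAL₀, VAL (abc-iut-rp-cx gen 2)

Seat abc-iut-rp-cx (gen 2), rung LADDER-ABC:A2.RP; PROOF-ONLY (no `def`). abc-iut-rp-m4's candidate `CandMochizuki41.H := ¬ Lin` («no single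
scalar carries the Θ-pilot's own Kummer-image log-volumes onto the hull log-volumes `thetaLocal` across the labels of `𝔽_l^⋇`») has the cells
CM ✗ / LS ✗ / P♭ ✗ / P♮ ✗ / FLIP ✓ in its own file and the `H ∧ S` corner at a shift bed (`CandMochizuki41Shift`). This file adds the three
cx columns of HOME/plan/repair/cx/EVAL-LOG.tsv, each a different corner:
* **K** (abc-iut-w4-d101's coarse-frame coset bed, HONEST incl. Step (x), orbit moving): **H ✓** (`m41_holds_k`: hull volume `−log p` at both
  labels, own volumes `−log p`, `−4·log p` — `r = 1` and `r = 1/4` at once, impossible; the flip's computation on an honest moving bed) together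
  with Statement ✓ (with equality) and `¬S` for every q-pinned q-datum (w4-d101, by name): the `H ∧ ¬S` corner at a SAT+ bed — RP-M51 is
  INSUFFICIENT for S with an honest witness (`m41_insufficient_at_k`).
* **SCAL₀** (door (b), abc-iut-rp-s3's `wSetting`): **H ✓** DEGENERATELY (`m41_holds_wSetting`: `thetaLocal = ⊤`, no real scalar reaches it)
  together with S ✓ — the `H ∧ S` corner at a bed of record, but only through non-finiteness (`m41_and_residual_at_wSetting`); this CONCURS
  with abc-iut-rp-m3's cell on abc-iut-rp-s2's pinned door-(b) bed (`CandMochizuki32Scal.M51_H_scal`, v2) — a second door-(b) witness.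
* **VAL** (door (a) value chart, abc-iut-rp-j2): **H ✗** DEGENERATELY (`lin_val`: `thetaLocal = 0` at every label, so `r = 0` is a scalar)
  together with S ✓ and Statement ✓ (`m41_fails_at_val`).
READING (neutral): on the cx columns RP-M51 tracks «the hull volume is finite, non-zero and label-constant while the own volumes scale by
j²» — true at K and FLIP, vacuous-true at SCAL₀, false at VAL by the accident `μ(hull) = 0`; it is independent of S (rp-m4's finding,
re-witnessed on honest beds). v2 (docstrings only; declarations unchanged): the row id is RP-M51 of HOME/plan/repair/CANDIDATES.tsv
(v1 wrote «RP-M41» after the candidate file's number k = 41; RP-M41 is abc-iut-rp-m2's existing-decl row). No side taken on [IUTchIII] Cor. 3.12 or on any author (S. Mochizuki, Scholze–Stix, K. Joshi); candidates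
are hypotheses; model data ≠ intended objects; typed ≠ proved.
-/

noncomputable section

namespace Summit.ABC.IUTFork.Repair.EvalM41Cells

open Set Cor312 Cor312.Checks Cor312.IdentifiedNonVacuity Cor312Vol Cor312Vol.NaiveWitness Cor312Vol.PinnedWitness
  Cor312Vol.PinnedHonest Cor312Vol.UnitWitness Cor312Vol.UnitCoset Cor312Vol.UnitCosetCoarse Literature.IUT.LogThetaLattice
  Summit.ABC.IUTFork.Repair.CandMochizuki41
open Thm311

variable (p : ℕ) [hp : Fact p.Prime]

/-! ## 1. K -/

/-- The own volume of every Kummer image at K: `−j²·log p` at the label `j = i+1`. [folklore] -/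
theorem ownVolAt_k (m : ℤ) (i : Fin toyIndex.lstar) (vQ : toyIndex.VQ) :
    ownVolAt (kFull p).toLatticeSituation (kSetting p) m (Setting.labelSucc i) vQ = -((((i : ℕ) + 1 : ℕ) : ℝ) ^ 2) * Real.log p := by
  unfold ownVolAt
  rw [show (kSetting p).thetaRegion m (Setting.labelSucc i) vQ = (kSetting p).thetaRegion 0 (Setting.labelSucc i) vQ from rfl,
    ← kSetting_thetaRegion3]
  rw [show ((kFull p).toLatticeSituation.D (kSetting p).n).logvol _ vQ ((kSetting p).thetaRegion3 (Setting.labelSucc i) vQ) =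
      (((i : ℕ) + 1 : ℕ) : ℝ) ^ 2 * (kSetting p).qLocal (Setting.labelSucc i) vQ from kSetting_scaled p i vQ, kSetting_qLocal]
  ring

/-- **RP-M51 `H` HOLDS at K**: hull volume `−log p` at the labels `1` and `2` (`kSetting_thetaLocal`), own volumes `−log p` and `−4·log p`.
[folklore] -/
theorem m41_holds_k : H (kFull p).toLatticeSituation (kSetting p) := by
  intro hlin
  obtain ⟨r, hr⟩ := hlin 0 ()
  have h0 := hr ⟨0, by decide⟩
  have h1 := hr ⟨1, by decide⟩
  rw [kSetting_thetaLocal, ownVolAt_k, WithTop.coe_eq_coe] at h0 h1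
  have hl := log_p_pos p
  push_cast at h0 h1
  nlinarith

/-- **RP-M51 is INSUFFICIENT for S with an honest witness**: at K, `H` ∧ typed Thm. 3.11 ∧ BridgeHyps ∧ pins ∧ `|log(q)| > 0` ∧ Step (x)
`LogvolInvariant` ∧ Statement hold while S fails for every q-pinned q-datum (w4-d101's cells BY NAME). [folklore] -/
theorem m41_insufficient_at_k :
    H (kFull p).toLatticeSituation (kSetting p) ∧ (kFull p).Statement ∧ BridgeHyps (kSetting p) ∧
      PinnedRegions3 (kFull p).toLatticeSituation (kSetting p) (cosetRegion p) (idealDatum p) ∧ (kSetting p).AbsLogQPos ∧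
      ((kFull p).D (kSetting p).n).LogvolInvariant ∧ (kSetting p).Statement ∧
      ¬ PilotKummerIndRelated (kFull p).toLatticeSituation (kSetting p) (cosetRegion p) (idealDatum p) :=
  ⟨m41_holds_k p, kFull_statement p, kSetting_bridgeHyps p, kSetting_pinnedRegions3 p, kSetting_absLogQPos p, kLine_logvolInvariant p 0,
    kSetting_statement p, kSetting_not_pilotKummerIndRelated p⟩

/-! ## 2. SCAL₀ -/

section Scal

open ScalarShells ScalarShellsThm311 ScalarShellsThm311Zero ObstructionSS6Witness ObstructionSS32

/-- **RP-M51 `H` HOLDS at SCAL₀, degenerately**: `thetaLocal = ⊤` at every label (`wSetting_thetaLocal_eq_top`), which no real scalar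
multiple of an own volume equals. [folklore] -/
theorem m41_holds_wSetting : H (sFull₀ p).toLatticeSituation (wSetting p) := by
  intro hlin
  obtain ⟨r, hr⟩ := hlin 0 ()
  have h0 := hr ⟨0, by decide⟩
  rw [wSetting_thetaLocal_eq_top] at h0
  exact WithTop.top_ne_coe h0

/-- The `H ∧ S` corner at a bed of record (door (b)), reached through non-finiteness only. [folklore] -/
theorem m41_and_residual_at_wSetting :
    H (sFull₀ p).toLatticeSituation (wSetting p) ∧
      PilotKummerIndRelated (sFull₀ p).toLatticeSituation (wSetting p) (wRho p) (qDatum p) ∧ ¬ (wSetting p).ThetaFinite :=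
  ⟨m41_holds_wSetting p, (door_b_all_levels p).2.2.1, (wSetting_price p).2.1⟩

end Scal

/-! ## 3. VAL -/

section Val

open CandJoshi23

omit hp in
/-- **(Lin) HOLDS at VAL, degenerately**: every hull volume is `μ(H_0) = 0` (`val_thetaLocal`), so the scalar `r = 0` works at every label.
[folklore] -/
theorem lin_val : Lin (vFull p).toLatticeSituation (valSetting p) := fun _ vQ =>
  ⟨0, fun i => by rw [val_thetaLocal, zero_mul]⟩

/-- **RP-M51 `H` FAILS at VAL** while S and the Statement hold there (rp-j2, by name). [folklore] -/
theorem m41_fails_at_val :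
    ¬ H (vFull p).toLatticeSituation (valSetting p) ∧
      PilotKummerIndRelated (vFull p).toLatticeSituation (valSetting p) (vRho p) (vQDatum p) ∧ (valSetting p).Statement :=
  ⟨fun h => h (lin_val p), val_residual p, val_statement p⟩

end Val

end Summit.ABC.IUTFork.Repair.EvalM41Cells

end
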